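import Summits.QuantumFields.BalabanUV.Beta.GAN24.S3RowV0
import Summits.QuantumFields.BalabanUV.Beta.GAN24.RowV0TableSymAn1At
import Summits.QuantumFields.BalabanUV.Beta.GAN24.E3UnitSplitLevelsVSymAn1At

/-!
# Road S3's BIRTH-0 V ROW FOR an1's SYMMETRISED BORDER TABLE: END **`shapeV0_at`** (twin of `S3RowV0SymAt`)

NOT IN PRINT — OUR BOOKKEEPING (road-P2 = `b2b-balaban-gan24-p2` gen 56, 2026-08-25; row G-an2-4 ∕ (CONV-C), the (α-0) chain at row D1's literal
OF RECORD (III′) `JsB12CombShSym`; [folklore] composition BY NAME; 0 `def`, 0 cite, 0 `def … : Prop`, 0 `sorry`).  Weight 0.  NEVER «G-an2-4 closed» as (CONV-C);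
NOT D1, NOT BetaPertH, NOT continuum, NOT Clay; NO campaign opened (an2 W-4) — a brick of the located `hUv⁰` transfer (road-P2 MEMO M-gan24p2-g56-1 §2(b) with M.77's
RAW-table socket `CombBornBorderLettersRaw`).

NAMING: in this package «Sym» in the ROOTED file names (`…SymAt`) means the UN-NEGATED rooted border `vhSAt ρ` (the OWNER's W15), while «An1» (these files) means an1's
(0.4)-SYMMETRISED border table `SymAveragingHessianCounts.symVhSAt ρ` — the type of the record field `SymTables.V`.  METHOD = the OWNER gan24-p1's gen-6 `mkroot.py` rule
(road-P2's `tools/mkstab.py`): the ROOTED file VERBATIM with `vhSAt (toSite r) ↦ symVhSAt (toSite r)`, asym's `SpineRooted.borderIncAt ↦ TaylorMassVHAn1At.symBorderIncAt`, an1's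
rooted support ∕ entry ∕ locality lemmas ↦ his SYMMETRISED ones (`symVhKerAt_eq_zero_left ∕ _right`, `abs_symVhKerAt_le ≤ 3ℓ²` «the SAME constant as the comb's», `locStencil_symVhSAt`,
block accessors by `packVH`); every ROOT-FREE lemma of the base modules BY NAME (not re-declared); same theorem names in the `…An1At` namespaces; base and rooted modules untouched;
zero-root bridges dropped (no root-0 base twin for the sym table).  Discharges NOTHING of (hS, hSall) ∕ hB by itself.
-/

noncomputable section

open Finset
open scoped BigOperators
open Literature.MathematicalPhysics.QuantumFieldTheory
open Literature.MathematicalPhysics.QuantumFieldTheory.Balaban1983to89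
open Literature.MathematicalPhysics.QuantumFieldTheory.Balaban1983to89.Beta
open B12Sec2to5 (l1 l1_nonneg)
open ExpKernelCalculus (MKer Zl Zl_nonneg l1_sub_symm)
open LatticeForm (quo)
open KernelSpecInstance (wH)
open KKTFluctuationKernel (GamΦ)
open OneStepResolventKernel (Fib LocStencil KInv)
open AffineAveraging (box toSite)
open AveragingHessianKernels (ell)
open Summit.QuantumFields.BalabanUV.Beta.SymAveragingHessianCounts (symVhSAt symVhKerAt symVhKerAt_eq_zero_left symVhKerAt_eq_zero_right abs_symVhKerAt_le
  locStencil_symVhSAt symVhSAt_symm)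
open BalabanCompositeJets (pushSum)
open Summit.QuantumFields.BalabanUV.Beta.GAN24.E3UnitSplit (e3OfS e3OfS_inl_inr e3OfS_inr)
open Summit.QuantumFields.BalabanUV.Beta.GAN24.E3UnitSplitLevelsVSymAn1At (e3VH0_unit_split_at)
open Summit.QuantumFields.BalabanUV.Beta.GAN24.TaylorVHSandwich (abs_twoChannel_le)
open Summit.QuantumFields.BalabanUV.Beta.GAN24.StencilSlotE3PhiLeg (phiLeg_three)
open Summit.QuantumFields.BalabanUV.Beta.GAN24.StencilSlotE3HLeg (legs_three)
open Summit.QuantumFields.BalabanUV.Beta.GAN24.RowV0TableSymAn1At (table_suppR_mf table_suppR_fm table_mass2_mf table_mass2_fm)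
open Summit.QuantumFields.BalabanUV.Beta.GAN24.S3RowV0 (leg_mono)

namespace Summit.QuantumFields.BalabanUV.Beta.GAN24.S3RowV0SymAn1At

variable {Lc : ℕ} [NeZero Lc]

/-! ## §1 One constant and one rate for all legs -/

/-! ## §2 ROW V0 -/

/-- **SHAPE ROW S3-V0 AT THE IN-BLOCK ROOT, UNCONDITIONAL** (`d = 3`, `Lc ≥ 1`; constants BEFORE the root): for every `r ∈ box (3+1) Lc` and every `n`, the
level-0 ROOTED SYMMETRIC (V-H) piece `symVhSAt (toSite r) 3 Lc κ u` (no `mfNeg`) pushed `n+1` times, read by the normalised third-jet functional of member `n+2`, is a local stencil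
family with constant `c₀V·(Lc⁻¹)^{n+1}` — the base `S3RowV0.shapeV0` with `vhS ↦ vhSAt (toSite r)`, the SAME `c₀V`, `δ`.  Engines BY NAME: MY
`E3UnitSplitLevelsVAt.e3VH0_unit_split_at`, `TaylorVHSandwich.abs_twoChannel_le`, `StencilSlotE3PhiLeg.phiLeg_three`, `StencilSlotE3HLeg.legs_three`, MY `RowV0TableAt`,
the base's `leg_mono`. [folklore] -/
theorem shapeV0_at (hL : 1 ≤ Lc) (cVH : ℝ) :
    ∃ c₀V δ : ℝ, 0 ≤ c₀V ∧ 0 < δ ∧ ∀ (r : Fin (3 + 1) → ℕ), r ∈ box (3 + 1) Lc → ∀ n : ℕ,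
      LocStencil (fun κ' u' x' z' a b => ((Lc : ℝ) ^ (n + 1 + 1)) ^ (2 * (3 + 1)) *
        e3OfS (Lc ^ (n + 1 + 1)) (fun κ u => ((((Lc : ℝ) ^ (3 + 1)) ^ (n + 1)) * cVH) • pushSum Lc (Lc ^ (n + 1)) (symVhSAt (toSite r) 3 Lc rfl κ u))
          κ' u' x' z' a b) (c₀V * ((Lc : ℝ)⁻¹) ^ (n + 1)) δ := by
  -- legs: one constant `A`, one rate `κ₁`
  obtain ⟨CΦ, δΦ, hδΦ, hCΦ, hΦrow, hΦcol⟩ := phiLeg_three (Lc := Lc)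
  obtain ⟨CH, κH, hκH, hCH, hHleg, hGleg⟩ := legs_three (Lc := Lc)
  set A : ℝ := max CΦ CH with hA
  have hA0 : 0 ≤ A := hCΦ.trans (le_max_left _ _)
  set κ₁ : ℝ := min δΦ κH with hκ₁
  have hκ₁pos : 0 < κ₁ := lt_min hδΦ hκH
  have hL0 : (0 : ℝ) < Lc := by exact_mod_cast (show 0 < Lc by omega)
  -- the n-free table mass unit and the sandwich constant
  set B₂ : ℝ := (((2 * (2 * (3 + 1) * Lc) + 1 : ℕ) : ℝ) ^ (3 + 1) *
      (((2 * (2 * (3 + 1) * Lc) + 1 : ℕ) : ℝ) ^ (3 + 1) * (3 * (ell (3 + 1) Lc : ℝ) ^ 2))) with hB₂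
  have hB₂0 : 0 ≤ B₂ := by positivity
  have hZ : 0 ≤ Zl (3 + 1) (κ₁ / 2) := Zl_nonneg (by positivity)
  set K : ℝ := 2 * ((Fintype.card (Fin (3 + 1)) : ℝ) ^ 3 * A ^ 3 * Real.exp (κ₁ * (4 * (3 + 1) * (8 * (3 + 1)) + 2 * (3 + 1))) * B₂ *
      Zl (3 + 1) (κ₁ / 2)) with hK
  have hK0 : 0 ≤ K := by positivity
  set c₀V : ℝ := |cVH| / (Lc : ℝ) ^ (3 + 1) * ((Lc : ℝ) ^ 2)⁻¹ * K with hc₀V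
  have hc₀V0 : 0 ≤ c₀V := by positivity
  refine ⟨c₀V, κ₁ / 2, hc₀V0, by positivity, fun r hr n => ?_⟩
  intro κ' u' x' z' a b
  dsimp only
  have hRHS : 0 ≤ c₀V * ((Lc : ℝ)⁻¹) ^ (n + 1) * Real.exp (-(κ₁ / 2) * (l1 (x' - u') + l1 (z' - u'))) := by positivity
  rcases a with α | μ
  · rcases b with β | ν
    · -- the field–field block: the two-channel template
      rw [e3VH0_unit_split_at (Lc := Lc) (d := 3) (toSite r) cVH (n + 1) (n + 1 + 1) rfl κ' u' x' z' α β]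
      have ecast : (((Lc ^ (n + 1 + 1) : ℕ) : ℝ)) = (Lc : ℝ) ^ (n + 1 + 1) := by push_cast; ring
      have hmP : 0 ≤ (Lc : ℝ) ^ (n + 1) * B₂ := mul_nonneg (pow_nonneg hL0.le _) hB₂0
      haveI : NeZero (Lc ^ (n + 1 + 1)) := ⟨pow_ne_zero _ (NeZero.ne Lc)⟩
      have h2 := abs_twoChannel_le (N := Lc ^ (n + 1 + 1)) (ι := Fin (3 + 1))
        (fun w l => ((Lc : ℝ) ^ (n + 1 + 1)) ^ (2 * (3 + 1)) *
          KInv (N := Lc ^ (n + 1 + 1)) (d := 3) (((Lc ^ (n + 1 + 1) : ℕ) : ℤ) • x') w (Sum.inr α) (Sum.inr l))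
        (fun w l => ((Lc : ℝ) ^ (n + 1 + 1)) ^ (3 + 2) * GamΦ (N := Lc ^ (n + 1 + 1)) α x' l w)
        (fun k u => ((Lc : ℝ) ^ (n + 1 + 1)) ^ (3 + 2) * wH (N := Lc ^ (n + 1 + 1)) k κ' (u - ((Lc ^ (n + 1 + 1) : ℕ) : ℤ) • u'))
        (fun y l' => ((Lc : ℝ) ^ (n + 1 + 1)) ^ (3 + 2) * wH (N := Lc ^ (n + 1 + 1)) l' β (y - ((Lc ^ (n + 1 + 1) : ℕ) : ℤ) • z'))
        (fun y l' => ((Lc : ℝ) ^ (n + 1 + 1)) ^ (2 * (3 + 1)) *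
          KInv (N := Lc ^ (n + 1 + 1)) (d := 3) y (((Lc ^ (n + 1 + 1) : ℕ) : ℤ) • z') (Sum.inr l') (Sum.inr β))
        (fun k u w y l l' => pushSum Lc (Lc ^ (n + 1)) (symVhSAt (toSite r) 3 Lc rfl k u) w y (Sum.inr l) (Sum.inl l'))
        (fun k u w y l l' => pushSum Lc (Lc ^ (n + 1)) (symVhSAt (toSite r) 3 Lc rfl k u) w y (Sum.inl l) (Sum.inr l'))
        (x' := x') (u' := u') (z' := z') (A := A) (κ := κ₁) (mP := (Lc : ℝ) ^ (n + 1) * B₂) (R := 8 * (3 + 1) * Lc ^ (n + 1 + 1))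
        hκ₁pos hA0 hmP
        (fun w l => leg_mono (hΦrow (n + 1) x' w α l) (le_max_left _ _) (min_le_left _ _) (l1_nonneg _) hCΦ)
        (fun w l => by
          have h := hGleg (n + 1) α l x' w
          rw [l1_sub_symm] at h
          exact leg_mono h (le_max_right _ _) (min_le_right _ _) (l1_nonneg _) hCH)
        (fun k u => leg_mono (hHleg (n + 1) k κ' u u') (le_max_right _ _) (min_le_right _ _) (l1_nonneg _) hCH)
        (fun y l' => leg_mono (hHleg (n + 1) l' β y z') (le_max_right _ _) (min_le_right _ _) (l1_nonneg _) hCH)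
        (fun y l' => leg_mono (hΦcol (n + 1) y z' l' β) (le_max_left _ _) (min_le_left _ _) (l1_nonneg _) hCΦ)
        (fun k u w y l l' h => table_suppR_mf hL hr (n + 1) k u w y l l' h)
        (fun k u w y l l' h => table_suppR_fm hL hr (n + 1) k u w y l l' h)
        (fun k u l l' S T => table_mass2_mf hL hr (n + 1) k u l l' S T)
        (fun k u l l' S T => table_mass2_fm hL hr (n + 1) k u l l' S T)
      rw [ecast] at h2
      -- the prefactor
      have hLp : (0 : ℝ) < ((Lc : ℝ) ^ (n + 1 + 1)) ^ 2 := by positivity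
      have hpre : |-(cVH / (Lc : ℝ) ^ (3 + 1)) * ((Lc : ℝ) ^ (n + 1 + 1)) ^ (-(2 : ℤ))| =
          |cVH| / (Lc : ℝ) ^ (3 + 1) * (((Lc : ℝ) ^ (n + 1 + 1)) ^ 2)⁻¹ := by
        rw [zpow_neg, zpow_ofNat, abs_mul, abs_neg, abs_div, abs_of_pos (pow_pos hL0 _), abs_inv, abs_of_pos hLp]
      -- the support ratio R/N = 8(3+1) is n-free
      have hRN : (4 : ℝ) * (3 + 1 : ℕ) * ((8 * (3 + 1) * Lc ^ (n + 1 + 1) : ℕ) : ℝ) / (Lc : ℝ) ^ (n + 1 + 1) + 2 * (3 + 1 : ℕ) =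
          4 * (3 + 1) * (8 * (3 + 1)) + 2 * (3 + 1) := by
        have hN0 : (Lc : ℝ) ^ (n + 1 + 1) ≠ 0 := pow_ne_zero _ hL0.ne'
        push_cast
        field_simp
        norm_num
      rw [hRN] at h2
      have hpow : (((Lc : ℝ) ^ (n + 1 + 1)) ^ 2)⁻¹ * (Lc : ℝ) ^ (n + 1) = ((Lc : ℝ) ^ 2)⁻¹ * ((Lc : ℝ)⁻¹) ^ (n + 1) := by
        have hL1 : (Lc : ℝ) ≠ 0 := hL0.ne'
        have e2 : ((Lc : ℝ) ^ (n + 1 + 1)) ^ 2 = (Lc : ℝ) ^ 2 * (Lc : ℝ) ^ (n + 1) * (Lc : ℝ) ^ (n + 1) := by ring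
        rw [e2, inv_pow, mul_inv, mul_inv, mul_assoc, mul_assoc, inv_mul_cancel₀ (pow_ne_zero _ hL1), mul_one]
      set E := Real.exp (-(κ₁ / 2) * (l1 (x' - u') + l1 (z' - u'))) with hE
      rw [abs_mul, hpre]
      calc |cVH| / (Lc : ℝ) ^ (3 + 1) * (((Lc : ℝ) ^ (n + 1 + 1)) ^ 2)⁻¹ * |_|
          ≤ |cVH| / (Lc : ℝ) ^ (3 + 1) * (((Lc : ℝ) ^ (n + 1 + 1)) ^ 2)⁻¹ *
              (2 * ((Fintype.card (Fin (3 + 1)) : ℝ) ^ 3 * A ^ 3 * Real.exp (κ₁ * (4 * (3 + 1) * (8 * (3 + 1)) + 2 * (3 + 1))) *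
                ((Lc : ℝ) ^ (n + 1) * B₂) * Zl (3 + 1) (κ₁ / 2) * E)) := mul_le_mul_of_nonneg_left h2 (by positivity)
        _ = |cVH| / (Lc : ℝ) ^ (3 + 1) * ((((Lc : ℝ) ^ (n + 1 + 1)) ^ 2)⁻¹ * (Lc : ℝ) ^ (n + 1)) * K * E := by rw [hK]; ring
        _ = c₀V * ((Lc : ℝ)⁻¹) ^ (n + 1) * E := by rw [hpow, hc₀V]; ring
    · simp only [e3OfS_inl_inr, mul_zero, abs_zero]
      exact hRHS
  · simp only [e3OfS_inr, mul_zero, abs_zero]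
    exact hRHS

end Summit.QuantumFields.BalabanUV.Beta.GAN24.S3RowV0SymAn1At

end
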